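import Summits.HubbardSuperconductivity.HubbardSuperconductivity.Theorems.AnisotropyChordTransferFsumBond

/-!
# Route `AnisotropyChord` / H0 rotor rung, route (1): **HYPOTHESIS F (f-sum from below) PROVED**
# (theory seat `hubbard-h0-rotor-theory-1` g12, memo ROTOR-THEORY-12 §184(h) «F routine»; critic-4 g9 P5 «needs t_b(a) ≥ t₀ > 0 uniformly
# in L: trial-state upper bound on E(M)»; prover seat `hubbard-h0-rotor-p1` g15)

Part 3 of the F chain (`…TransferFsumIdentity`, `…TransferFsumBond`): a UNIFORM LOWER BOUND ON THE EXCHANGE CORRELATION of a Perron sector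
amplitude, by comparing its energy with the uniform (exchangeable) trial state of the same sector:

* `perron_energy_bond_sum` — the energy identity `¼ Σ_{x∼y}(brkMass − hopCorr) + (1−Δ)(D/8 − ¼ Σ_{x∼y} brkMass) = E(M) + D/8`;
* `sectorE_le_uniform` — Rayleigh–Ritz with the sector indicator: `(E(M) + D/8)·|S| ≤ (1−Δ)·D·(|S|/8 − A/2)`, where
  `V(V−1)·A = n(V−n)·|S|` is the tree's exchangeability count (`Stiffness.Exch.card_card_pred_mul_A`);
* **`hopCorr_perron_ge`** — for `0 ≤ Δ` and `L ≥ 2`: `hopCorr a 0 e₀ ≥ (1−Δ)·(V²/2 − 2M²)/(V(V−1))`, `V = L²`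
  (`= 2(1−Δ)ρ(1−ρ)·V/(V−1)`, `ρ = N/V`: the mean-field hopping, attained by the uniform state at `Δ = 1`);
* **`fsumLower_holds`** — HYPOTHESIS F: `FsumLower L Δ M ((1−Δ)(L⁴/2 − 2M²)/(L²(L²−1)))` for `L ≥ 3`, `0 ≤ Δ`;
  `fsumLower_quarter` (`FsumLower L Δ M ((1−Δ)/4)` once `16M² ≤ L⁴`, `Δ ≤ 1`) and the eventually-in-`L` family
  **`fsumLower_eventually`** on the sectors `|j| ≤ k + 1` — exactly the F-input of `symmetricSectorGap_of_compressibility_saturation`.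

So PROPOSITION N's hypothesis F is discharged: (H2) ⇐ K (compressibility) + R₀ (k = 0 Feynman saturation) alone, for `0 ≤ Δ < 1`.
All folklore (variational principle + exchangeability; lattice f-sum rule).
-/

set_option linter.dupNamespace false
set_option autoImplicit false

noncomputable section

open Finset Filter Topology
open Literature.MathematicalPhysics.QuantumLattice Literature.Probability.LatticeModels
open Summit.HubbardSuperconductivity.HubbardSuperconductivity.Theorems.AnisotropyChord.InsertionEntropy
open Summit.HubbardSuperconductivity.HubbardSuperconductivity.Theorems.AnisotropyChord.Tower

namespace Summit.HubbardSuperconductivity.HubbardSuperconductivity.Theorems.AnisotropyChord.Transfer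

variable {L : ℕ} [NeZero L]

/-! ## The energy of a Perron amplitude as a bond sum -/

/-- **energy identity:** `¼ Σ_{x∼y}(brkMass a − hopCorr a) + (1−Δ)(D/8 − ¼ Σ_{x∼y} brkMass a) = E(M) + D/8` for a Perron
sector amplitude (`perron_energy_real` in bond-sum form). [folklore] -/
theorem perron_energy_bond_sum {Δ M : ℝ} {a : TensorIndex (TorusSite 2 L) 2 → ℝ}
    (ha : IsPerronSectorGroundAmplitude L Δ M a) :
    (1/4 : ℝ) * (∑ x : TorusSite 2 L, ∑ y, if (torusGraph 2 L).Adj x y then (brkMass a x y - hopCorr a x y) else 0)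
      + (1 - Δ) * ((1/8 : ℝ) * (∑ x : TorusSite 2 L, ∑ y, if (torusGraph 2 L).Adj x y then (1:ℝ) else 0)
          - (1/4 : ℝ) * ∑ x : TorusSite 2 L, ∑ y, if (torusGraph 2 L).Adj x y then brkMass a x y else 0)
      = sectorE L Δ M + (1/8 : ℝ) * ∑ x : TorusSite 2 L, ∑ y, if (torusGraph 2 L).Adj x y then (1:ℝ) else 0 := by
  have h := perron_energy_real ha
  rw [← sectorE_eq] at h
  have hsplit : ∑ σ, a σ * (fmOp (torusGraph 2 L) a σ + (1 - Δ) * (isingW (torusGraph 2 L) σ * a σ))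
      = (∑ σ, a σ * fmOp (torusGraph 2 L) a σ) + (1 - Δ) * ∑ σ, isingW (torusGraph 2 L) σ * a σ ^ 2 := by
    rw [Finset.mul_sum, ← Finset.sum_add_distrib]
    refine Finset.sum_congr rfl fun σ _ => by ring
  rw [hsplit, inner_fmOp_eq_bond_sum, inner_isingW_eq_bond_sum, ha.unit, mul_one] at h
  exact h

/-! ## The uniform trial state of the sector -/

/-- `zerosCard σ = V − occ σ`. [folklore] -/
theorem zerosCard_eq_card_sub_occ (σ : TensorIndex (TorusSite 2 L) 2) :
    zerosCard σ = (Fintype.card (TorusSite 2 L) : ℝ) - (Stiffness.Exch.occ σ : ℝ) := by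
  have h := Stiffness.Exch.card_zero_add_occ σ
  unfold zerosCard
  have h' : (((univ.filter fun y => σ y = 0).card : ℕ) : ℝ) + (Stiffness.Exch.occ σ : ℝ)
      = (Fintype.card (TorusSite 2 L) : ℝ) := by exact_mod_cast h
  linarith

/-- **Rayleigh–Ritz with the uniform sector state:** if the sector `zerosCard = V/2 + M` is the occupation sector `occ = m`, then
`(E(M) + D/8)·|S_m| ≤ (1−Δ)·(D|S_m|/8 − ½ Σ_{x∼y} A_m(x,y))` (`A = 0` on the trial state by swap invariance; Ising energy by
`inner_isingW_eq_bond_sum`; `#{σ ∈ S_m : σ_x ≠ σ_y} = 2A_m(x,y)`). [folklore] -/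
theorem sectorE_le_uniform {Δ M : ℝ} (m : ℕ)
    (hm : ((Fintype.card (TorusSite 2 L) : ℝ) - (m : ℝ)) = (Fintype.card (TorusSite 2 L) : ℝ) / 2 + M) :
    (sectorE L Δ M + (1/8 : ℝ) * ∑ x : TorusSite 2 L, ∑ y, if (torusGraph 2 L).Adj x y then (1:ℝ) else 0)
        * ((Stiffness.Exch.sector (TorusSite 2 L) m).card : ℝ)
      ≤ (1 - Δ) * ((1/8 : ℝ) * (∑ x : TorusSite 2 L, ∑ y, if (torusGraph 2 L).Adj x y then (1:ℝ) else 0)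
            * ((Stiffness.Exch.sector (TorusSite 2 L) m).card : ℝ)
          - (1/4 : ℝ) * ∑ x : TorusSite 2 L, ∑ y,
              if (torusGraph 2 L).Adj x y then (2 * (Stiffness.Exch.A m x y : ℝ)) else 0) := by
  -- the trial state
  set b : TensorIndex (TorusSite 2 L) 2 → ℝ := fun σ => if Stiffness.Exch.occ σ = m then 1 else 0 with hb
  have hbsq : ∀ σ, b σ ^ 2 = if Stiffness.Exch.occ σ = m then 1 else 0 := by
    intro σ; simp only [hb]; split_ifs <;> norm_num
  -- support
  have hsupp : ∀ σ, b σ ≠ 0 → zerosCard σ = (Fintype.card (TorusSite 2 L) : ℝ) / 2 + M := by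
    intro σ hσ
    have hocc : Stiffness.Exch.occ σ = m := by
      by_contra h; exact hσ (by simp only [hb, if_neg h])
    rw [zerosCard_eq_card_sub_occ, hocc, hm]
  -- norm
  have hnorm : ∑ σ, b σ ^ 2 = ((Stiffness.Exch.sector (TorusSite 2 L) m).card : ℝ) := by
    simp only [hbsq]
    rw [← Finset.sum_filter, Finset.sum_const, nsmul_eq_mul, mul_one]
    rfl
  -- A kills the trial state
  have hA : fmOp (torusGraph 2 L) b = fun _ => 0 := by
    apply fmOp_of_swapInvariant
    intro x y _ σ
    simp only [hb, Stiffness.Exch.occ_comp_perm]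
  -- broken-bond masses of the trial state
  have hbrk : ∀ x y : TorusSite 2 L, brkMass b x y = 2 * (Stiffness.Exch.A m x y : ℝ) := by
    intro x y
    have hc := Stiffness.Exch.card_ne_eq_two_mul_A (α := TorusSite 2 L) m x y
    have hc' : ((((Stiffness.Exch.sector (TorusSite 2 L) m).filter fun σ => σ x ≠ σ y).card : ℕ) : ℝ)
        = 2 * (Stiffness.Exch.A m x y : ℝ) := by exact_mod_cast hc
    rw [← hc']
    unfold brkMass
    simp only [hbsq, brk]
    rw [Finset.card_filter]
    push_cast
    unfold Stiffness.Exch.sector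
    rw [Finset.sum_filter]
    refine Finset.sum_congr rfl fun σ _ => ?_
    by_cases h1 : Stiffness.Exch.occ σ = m <;> by_cases h2 : σ x = σ y <;> simp [h1, h2]
  -- Rayleigh–Ritz
  have hR := rayleigh_real Δ M b hsupp
  rw [← sectorE_eq] at hR
  have hrhs : ∑ σ, b σ * (fmOp (torusGraph 2 L) b σ + (1 - Δ) * (isingW (torusGraph 2 L) σ * b σ))
      = (1 - Δ) * ∑ σ, isingW (torusGraph 2 L) σ * b σ ^ 2 := by
    rw [Finset.mul_sum]
    refine Finset.sum_congr rfl fun σ _ => ?_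
    rw [show fmOp (torusGraph 2 L) b σ = 0 from congrFun hA σ]; ring
  rw [hrhs, inner_isingW_eq_bond_sum, hnorm] at hR
  simp only [hbrk] at hR
  exact hR

/-! ## The exchange correlation of a Perron amplitude is bounded below -/

/-- the ordered edge count `D` of the torus is positive for `L ≥ 2`. [folklore] -/
theorem edgeCount_pos (hL : 2 ≤ L) :
    0 < ∑ x : TorusSite 2 L, ∑ y, if (torusGraph 2 L).Adj x y then (1:ℝ) else 0 := by
  have h1 : (1 : ℝ) ≤ ∑ y, if (torusGraph 2 L).Adj (0 : TorusSite 2 L) y then (1:ℝ) else 0 := by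
    have h := Finset.single_le_sum (f := fun y => if (torusGraph 2 L).Adj (0 : TorusSite 2 L) y then (1:ℝ) else 0)
      (fun y _ => by positivity) (Finset.mem_univ ((0 : TorusSite 2 L) + Pi.single 0 1))
    simp only [if_pos (torusGraph_adj_add_single hL (0 : TorusSite 2 L) 0)] at h
    exact h
  have h2 : (∑ y, if (torusGraph 2 L).Adj (0 : TorusSite 2 L) y then (1:ℝ) else 0)
      ≤ ∑ x : TorusSite 2 L, ∑ y, if (torusGraph 2 L).Adj x y then (1:ℝ) else 0 :=
    Finset.single_le_sum (f := fun x : TorusSite 2 L => ∑ y, if (torusGraph 2 L).Adj x y then (1:ℝ) else 0)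
      (fun x _ => Finset.sum_nonneg fun y _ => by positivity) (Finset.mem_univ (0 : TorusSite 2 L))
  linarith

/-- **THE EXCHANGE CORRELATION IS BOUNDED BELOW (uniformly in `L`):** for a Perron sector amplitude `a` of `H(Δ)`, `0 ≤ Δ`,
`L ≥ 2`: `hopCorr a 0 e₀ ≥ (1−Δ)·(V²/2 − 2M²)/(V(V−1))`, `V = L²` (`= 2(1−Δ)·n(V−n)/(V(V−1))`, `n = V/2 + M`: the mean-field
hopping of the uniform sector state). Variational: the energy identity `perron_energy_bond_sum`, the trial bound
`sectorE_le_uniform`, the one-bond constant `hopCorr_perron_adj` and the exchangeability count. [folklore] -/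
theorem hopCorr_perron_ge {Δ M : ℝ} {a : TensorIndex (TorusSite 2 L) 2 → ℝ}
    (ha : IsPerronSectorGroundAmplitude L Δ M a) (hL : 2 ≤ L) (hΔ : 0 ≤ Δ) :
    (1 - Δ) * ((((L : ℝ) ^ 2) ^ 2 / 2 - 2 * M ^ 2) / ((L : ℝ) ^ 2 * ((L : ℝ) ^ 2 - 1)))
      ≤ hopCorr a 0 (Pi.single 0 1) := by
  obtain ⟨n, hnV, hn⟩ := perron_natSector ha
  set V : ℕ := Fintype.card (TorusSite 2 L) with hVdef
  have hVL : (V : ℝ) = (L : ℝ) ^ 2 := by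
    have hcardT : Fintype.card (TorusSite 2 L) = L ^ 2 := by rw [Fintype.card_fun, ZMod.card, Fintype.card_fin]
    rw [hVdef, hcardT]; push_cast; ring
  have hV4 : (4 : ℝ) ≤ V := by
    rw [hVL]; have : (2 : ℝ) ≤ L := by exact_mod_cast hL
    nlinarith
  -- the occupation number of the sector
  set m : ℕ := V - n with hmdef
  have hmV : (m : ℝ) = (V : ℝ) - n := by rw [hmdef]; push_cast [Nat.cast_sub hnV]; ring
  have hm : ((V : ℝ) - (m : ℝ)) = (V : ℝ) / 2 + M := by rw [hmV, ← hn]; ring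
  -- abbreviations
  set D : ℝ := ∑ x : TorusSite 2 L, ∑ y, if (torusGraph 2 L).Adj x y then (1:ℝ) else 0 with hD
  set P : ℝ := ((Stiffness.Exch.sector (TorusSite 2 L) m).card : ℝ) with hP
  set Sm : ℝ := ∑ x : TorusSite 2 L, ∑ y, if (torusGraph 2 L).Adj x y then brkMass a x y else 0 with hSm
  set h₀ : ℝ := hopCorr a 0 (Pi.single 0 1) with hh₀
  have hDpos : 0 < D := edgeCount_pos hL
  -- the exchangeability constant A₀ on adjacent pairs
  set A₀ : ℝ := (Stiffness.Exch.A m (0 : TorusSite 2 L) ((0 : TorusSite 2 L) + Pi.single 0 1) : ℝ) with hA₀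
  have hne0 : (0 : TorusSite 2 L) ≠ 0 + Pi.single 0 1 := (Stiffness.add_single_ne_self hL 0 0).symm
  have hAconst : ∀ x y : TorusSite 2 L, (torusGraph 2 L).Adj x y → (Stiffness.Exch.A m x y : ℝ) = A₀ := by
    intro x y hxy
    rw [hA₀]; exact_mod_cast Stiffness.Exch.A_const m hxy.ne hne0
  have hAcount : (V : ℝ) * ((V : ℝ) - 1) * A₀ = (n : ℝ) * ((V : ℝ) - n) * P := by
    have h := Stiffness.Exch.card_card_pred_mul_A (α := TorusSite 2 L) m hne0
    have h' : ((Fintype.card (TorusSite 2 L) : ℕ) : ℝ) * (((Fintype.card (TorusSite 2 L) - 1 : ℕ)) : ℝ) * A₀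
        = (m : ℝ) * (((Fintype.card (TorusSite 2 L) - m : ℕ)) : ℝ) * P := by
      rw [hA₀, hP]; exact_mod_cast h
    have h1V : 1 ≤ V := le_trans (by norm_num) (by exact_mod_cast (le_trans hV4 le_rfl : (4:ℝ) ≤ V) : 4 ≤ V)
    rw [← hVdef, Nat.cast_sub h1V, Nat.cast_sub (Nat.sub_le V n)] at h'
    rw [hmV] at h'
    push_cast at h'
    linear_combination h'
  -- bond sums: hopCorr is constant, 2A is constant on edges
  have hSh : (∑ x : TorusSite 2 L, ∑ y, if (torusGraph 2 L).Adj x y then (brkMass a x y - hopCorr a x y) else 0)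
      = Sm - h₀ * D := by
    rw [hSm, hD, Finset.mul_sum, ← Finset.sum_sub_distrib]
    refine Finset.sum_congr rfl fun x _ => ?_
    rw [Finset.mul_sum, ← Finset.sum_sub_distrib]
    refine Finset.sum_congr rfl fun y _ => ?_
    by_cases hxy : (torusGraph 2 L).Adj x y
    · rw [if_pos hxy, if_pos hxy, if_pos hxy, hopCorr_perron_adj ha hxy, ← hh₀]; ring
    · rw [if_neg hxy, if_neg hxy, if_neg hxy]; ring
  have hSA : (∑ x : TorusSite 2 L, ∑ y, if (torusGraph 2 L).Adj x y then (2 * (Stiffness.Exch.A m x y : ℝ)) else 0)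
      = 2 * A₀ * D := by
    rw [hD, Finset.mul_sum]
    refine Finset.sum_congr rfl fun x _ => ?_
    rw [Finset.mul_sum]
    refine Finset.sum_congr rfl fun y _ => ?_
    by_cases hxy : (torusGraph 2 L).Adj x y
    · rw [if_pos hxy, if_pos hxy, hAconst x y hxy]; ring
    · rw [if_neg hxy, if_neg hxy]; ring
  -- the two energy statements
  have hE := perron_energy_bond_sum ha
  rw [hSh] at hE
  have hU := sectorE_le_uniform (L := L) (Δ := Δ) (M := M) m hm
  rw [hSA, ← hE] at hU
  -- positivity facts
  have hP0 : 0 ≤ P := by rw [hP]; positivity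
  have hSm0 : 0 ≤ Sm := by
    rw [hSm]; exact Finset.sum_nonneg fun x _ => Finset.sum_nonneg fun y _ => by
      split_ifs
      · exact brkMass_nonneg a x y
      · exact le_rfl
  -- from hU:  h₀ D P ≥ Δ Sm P + 2(1−Δ) A₀ D ≥ 2 (1−Δ) A₀ D
  have hkey : 2 * (1 - Δ) * A₀ * D ≤ h₀ * D * P := by nlinarith [hU, mul_nonneg hΔ (mul_nonneg hSm0 hP0)]
  have hkey' : 2 * (1 - Δ) * A₀ ≤ h₀ * P := by
    have := le_of_mul_le_mul_right (by nlinarith [hkey] : 2 * (1 - Δ) * A₀ * D ≤ h₀ * P * D) hDpos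
    exact this
  -- P > 0: the sector of `a` is non-empty
  have hPpos : 0 < P := by
    obtain ⟨σ₀, hσ₀⟩ : ∃ σ₀, a σ₀ ≠ 0 := by
      by_contra hall; push Not at hall
      have : ∑ σ, a σ ^ 2 = 0 := Finset.sum_eq_zero fun σ _ => by rw [hall σ]; ring
      rw [ha.unit] at this; exact one_ne_zero this
    have hz := perron_support ha σ₀ hσ₀
    rw [zerosCard_eq_card_sub_occ, ← hVdef] at hz
    have hocc : Stiffness.Exch.occ σ₀ = m := by
      have h1 : (Stiffness.Exch.occ σ₀ : ℝ) = (m : ℝ) := by rw [hmV]; linarith [hm]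
      exact_mod_cast h1
    have hmem : σ₀ ∈ Stiffness.Exch.sector (TorusSite 2 L) m := by
      unfold Stiffness.Exch.sector; rw [Finset.mem_filter]; exact ⟨Finset.mem_univ _, hocc⟩
    rw [hP]; exact_mod_cast Finset.card_pos.2 ⟨σ₀, hmem⟩
  -- conclude
  have hVV : 0 < (V : ℝ) * ((V : ℝ) - 1) := by nlinarith
  rw [← hVL]
  have hnum : ((V : ℝ) ^ 2 / 2 - 2 * M ^ 2) = 2 * ((n : ℝ) * ((V : ℝ) - n)) := by
    have : (n : ℝ) = (V : ℝ) / 2 + M := hn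
    rw [this]; ring
  rw [hnum, show (1 - Δ) * (2 * ((n : ℝ) * ((V : ℝ) - n)) / ((V : ℝ) * ((V : ℝ) - 1)))
      = (2 * (1 - Δ) * ((n : ℝ) * ((V : ℝ) - n))) / ((V : ℝ) * ((V : ℝ) - 1)) by ring, div_le_iff₀ hVV]
  have h3 : 2 * (1 - Δ) * ((n : ℝ) * ((V : ℝ) - n)) * P ≤ h₀ * ((V : ℝ) * ((V : ℝ) - 1)) * P := by
    have h4 := mul_le_mul_of_nonneg_right hkey' hVV.le
    calc 2 * (1 - Δ) * ((n : ℝ) * ((V : ℝ) - n)) * P = 2 * (1 - Δ) * ((V : ℝ) * ((V : ℝ) - 1) * A₀) := by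
          rw [hAcount]; ring
      _ = 2 * (1 - Δ) * A₀ * ((V : ℝ) * ((V : ℝ) - 1)) := by ring
      _ ≤ h₀ * P * ((V : ℝ) * ((V : ℝ) - 1)) := h4
      _ = h₀ * ((V : ℝ) * ((V : ℝ) - 1)) * P := by ring
  exact le_of_mul_le_mul_right h3 hPpos

/-! ## HYPOTHESIS F -/

/-- **HYPOTHESIS F PROVED (exact constant):** for `L ≥ 3` and `0 ≤ Δ`,
`FsumLower L Δ M ((1−Δ)(L⁴/2 − 2M²)/(L²(L²−1)))`, i.e. `⟨c a,(H − E)c a⟩ ≥ (1−Δ)(L⁴/2 − 2M²)/(L²(L²−1))` for every Perron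
sector amplitude (f-sum ≥ exchange correlation ≥ mean-field hopping of the uniform state).
[conjecture: support statement F of PROPOSITION N (theory seat hubbard-h0-rotor-theory-1, cycle 12) — PROVED here] -/
theorem fsumLower_holds {Δ M : ℝ} (hL : 3 ≤ L) (hΔ : 0 ≤ Δ) :
    FsumLower L Δ M ((1 - Δ) * ((((L : ℝ) ^ 2) ^ 2 / 2 - 2 * M ^ 2) / ((L : ℝ) ^ 2 * ((L : ℝ) ^ 2 - 1)))) := by
  intro a ha
  have hL2 : 2 ≤ L := le_trans (by norm_num) hL
  have hLpos : (0 : ℝ) < L := by exact_mod_cast (by omega : 0 < L)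
  have hcard : (Fintype.card (TorusSite 2 L) : ℝ) = (L : ℝ) ^ 2 := by
    have hcardT : Fintype.card (TorusSite 2 L) = L ^ 2 := by rw [Fintype.card_fun, ZMod.card, Fintype.card_fin]
    rw [hcardT]; push_cast; ring
  rw [hcard, mul_div_assoc, div_self (by positivity), mul_one]
  exact le_trans (hopCorr_perron_ge ha hL2 hΔ) (hopCorr_le_fsumC ha hL)

/-- `FsumLower` is monotone in the constant. [folklore] -/
theorem fsumLower_mono {Δ M f₀ f₁ : ℝ} (hf : f₁ ≤ f₀) (h : FsumLower L Δ M f₀) : FsumLower L Δ M f₁ := by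
  intro a ha
  have hc : 0 ≤ (Fintype.card (TorusSite 2 L) : ℝ) / (L : ℝ) ^ 2 := by positivity
  have := h a ha
  have e : ∀ f : ℝ, f * (Fintype.card (TorusSite 2 L) : ℝ) / (L : ℝ) ^ 2
      = f * ((Fintype.card (TorusSite 2 L) : ℝ) / (L : ℝ) ^ 2) := fun f => by ring
  rw [e] at this ⊢
  exact le_trans (mul_le_mul_of_nonneg_right hf hc) this

/-- **HYPOTHESIS F with the uniform constant `(1−Δ)/4`** on the sectors `16 M² ≤ L⁴` (`0 ≤ Δ ≤ 1`, `L ≥ 3`). [folklore] -/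
theorem fsumLower_quarter {Δ M : ℝ} (hL : 3 ≤ L) (hΔ0 : 0 ≤ Δ) (hΔ1 : Δ ≤ 1)
    (hM : 16 * M ^ 2 ≤ ((L : ℝ) ^ 2) ^ 2) : FsumLower L Δ M ((1 - Δ) / 4) := by
  apply fsumLower_mono _ (fsumLower_holds hL hΔ0)
  have hL3 : (3 : ℝ) ≤ L := by exact_mod_cast hL
  have hV : (9 : ℝ) ≤ (L : ℝ) ^ 2 := by nlinarith
  set V : ℝ := (L : ℝ) ^ 2 with hVdef
  have hVV : 0 < V * (V - 1) := by nlinarith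
  rw [div_eq_mul_one_div (1 - Δ) 4, ← mul_div_assoc]
  rw [mul_div_assoc]
  apply mul_le_mul_of_nonneg_left _ (by linarith)
  rw [div_le_div_iff₀ (by norm_num) hVV]
  nlinarith [hM, hV]

/-- **the F-input of the compressibility chain, DISCHARGED:** for `0 ≤ Δ ≤ 1` and every `k`, eventually in `L`, `FsumLower L Δ j ((1−Δ)/4)`
on all sectors `|j| ≤ k + 1`. [folklore] -/
theorem fsumLower_eventually {Δ : ℝ} (hΔ0 : 0 ≤ Δ) (hΔ1 : Δ ≤ 1) (k : ℕ) :
    ∀ᶠ L : ℕ in atTop, ∀ [NeZero L], ∀ j : ℤ, |j| ≤ ((k + 1 : ℕ) : ℤ) → FsumLower L Δ (j : ℝ) ((1 - Δ) / 4) := by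
  filter_upwards [eventually_ge_atTop (2 * (k + 1) + 3)] with L hL
  intro _ j hj
  apply fsumLower_quarter (by omega) hΔ0 hΔ1
  have hjR : |(j : ℝ)| ≤ (k + 1 : ℝ) := by
    have : (|j| : ℝ) ≤ ((k + 1 : ℕ) : ℝ) := by exact_mod_cast hj
    push_cast at this
    exact this
  have hj2 : (j : ℝ) ^ 2 ≤ ((k : ℝ) + 1) ^ 2 := by
    have h0 : 0 ≤ (k : ℝ) + 1 := by positivity
    calc (j : ℝ) ^ 2 = |(j : ℝ)| ^ 2 := (sq_abs _).symm
      _ ≤ ((k : ℝ) + 1) ^ 2 := pow_le_pow_left₀ (abs_nonneg _) hjR 2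
  have hLk : 2 * ((k : ℝ) + 1) ≤ L := by
    have : ((2 * (k + 1) + 3 : ℕ) : ℝ) ≤ L := by exact_mod_cast hL
    push_cast at this; linarith
  have hk0 : 0 ≤ (k : ℝ) + 1 := by positivity
  have hL2 : (2 : ℝ) ≤ L := by linarith
  have hL4 : (4 : ℝ) ≤ (L : ℝ) ^ 2 := by nlinarith
  have hsq : (2 * ((k : ℝ) + 1)) ^ 2 ≤ (L : ℝ) ^ 2 := pow_le_pow_left₀ (by positivity) hLk 2
  calc 16 * (j : ℝ) ^ 2 ≤ 16 * ((k : ℝ) + 1) ^ 2 := by linarith [hj2]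
    _ = 4 * (2 * ((k : ℝ) + 1)) ^ 2 := by ring
    _ ≤ 4 * (L : ℝ) ^ 2 := by linarith [hsq]
    _ ≤ (L : ℝ) ^ 2 * (L : ℝ) ^ 2 := by nlinarith [hL4]
    _ = ((L : ℝ) ^ 2) ^ 2 := by ring

end Summit.HubbardSuperconductivity.HubbardSuperconductivity.Theorems.AnisotropyChord.Transfer
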